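import Mathlib
import Summits.ResolutionOfSingularities.ResolutionOfSingularities.Theses.SyzygyFlattening
import Summits.ResolutionOfSingularities.ResolutionOfSingularities.Theorems.SyzygyFlatteningDefs
import Summits.ResolutionOfSingularities.ResolutionOfSingularities.Theorems.SyzygyFlatteningHigherRankTerminationTowerStageBasic
import Summits.ResolutionOfSingularities.ResolutionOfSingularities.Theorems.SyzygyFlatteningHigherRankTerminationLocAt
import Summits.ResolutionOfSingularities.ResolutionOfSingularities.Theorems.SyzygyFlatteningHigherRankTerminationTowerLocalisation
import Summits.ResolutionOfSingularities.ResolutionOfSingularities.Theorems.SyzygyFlatteningRankOneTerminationSyzygyIndexPos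
import Summits.ResolutionOfSingularities.ResolutionOfSingularities.Theorems.SyzygyFlatteningRankOneTerminationStageNormal
import Summits.ResolutionOfSingularities.ResolutionOfSingularities.Theorems.SyzygyFlatteningRankOneTerminationStageDim
import Summits.ResolutionOfSingularities.ResolutionOfSingularities.Theorems.SyzygyFlatteningRankOneTerminationR1OfNormal
import Literature.AlgebraicGeometry.Resolution.NormalSurfaceSingularLocus
import Literature.AlgebraicGeometry.Resolution.RegularLocalRingsProofs
import HarnessLib

/-!
# `RankOneTermination` — the curve case, surface isolation, and the reduction of the crux to its
two open cores (crux stmt-ResolutionOfSingularities-17044, line `birth`)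

Route `ResolutionOfSingularities/SyzygyFlattening`, crux #2 `RankOneTermination`: along every
rank-one, dimension-zero valuation ring `O ⊇ A ⊇ k` of `K = Frac A` the syzygy-flattening tower
`T₀ = locAt O A`, `T_{m+1} = locAt O (nrm (chart O T_m))` reaches a regular local ring
(`TowerTerminates O A`; vocabulary of `Theorems/SyzygyFlatteningDefs.lean`).

Call a stage `T` ISOLATED when every non-maximal prime `𝔭` of the local ring `T` has regular
localisation `T_𝔭` (the centre of the valuation is an isolated point of the non-regular locus, or
a regular point).  With the wave-1 theorems of the line (`stub_syzygyIndex_pos`,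
`stub_stageNormal`, `stub_stageDim`, `stub_R1_of_normal`) this file proves, unconditionally:

* `isNoetherianRing_tower`, `isLocalRing_tower` — every stage is a Noetherian local ring;
* `stub_curveCase` / `towerTerminates_of_syzygyIndex_le_one` — **the curve case**: if
  `tr.deg_k K ≤ 1` then `T₁` is a regular local ring, for EVERY valuation ring `O ⊇ A` (no rank or
  dimension hypothesis): `T₁` is a normal Noetherian local domain of dimension `≤ 1`;
* `stub_surfaceIsolated` — **surfaces are isolated from `T₁` on**: if `tr.deg_k K ≤ 2`, every
  stage `T_m`, `m ≥ 1`, is isolated (normal Noetherian domains of dimension `≤ 2` are `R₁`);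
* `eventually_isolated_of_towerTerminates` — a terminating tower is eventually isolated (a regular
  stage is a fixed point, `tower_eq_of_regular`, and all its localisations are regular, Serre);
* `stub_rankOneReduction` — **the kernel-checked reduction of the crux**:
  `RankOneTermination ↔ IsoHigher ∧ IsolatedTerminates`, where `IsoHigher` = "for `n ≥ 3` the
  tower is eventually isolated" and `IsolatedTerminates` = "for `n ≥ 2` an eventually isolated
  tower terminates" (both spelled out in the statement; they are the two registered open stubs
  `stub_isoHigher`, `stub_isolatedTerminates` of the line).  `→` uses
  `eventually_isolated_of_towerTerminates`; `←` is the line's composition (`n = 1`: curve case;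
  `n = 2`: surface isolation with `m₀ = 1`; `n ≥ 3`: `IsoHigher`).
-/

noncomputable section

-- single-problem summit: the doubled namespace component `ResolutionOfSingularities` is forced
set_option linter.dupNamespace false

namespace Summit.ResolutionOfSingularities.ResolutionOfSingularities.Theorems.SyzygyFlattening

open Summit.ResolutionOfSingularities.ResolutionOfSingularities.Theses.SyzygyFlattening
  (RankOneTermination)
open IsLocalRing

variable {k K : Type} [Field k] [Field K] [Algebra k K]

/-! ## Stage invariants -/

/-- Every stage of the tower is a Noetherian ring (it is essentially of finite type over `k`,
`essFiniteType_tower`). [folklore] -/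
theorem isNoetherianRing_tower (O : ValuationSubring K) (A : Subalgebra k K)
    (hk : ∀ c : k, algebraMap k K c ∈ O) (hFG : A.FG) (hFrac : IsFractionRing ↥A K)
    (hAO : A.toSubring ≤ O.toSubring) (m : ℕ) : IsNoetherianRing ↥(tower O A m) :=
  haveI := essFiniteType_tower O A hk hFG hFrac hAO m
  Algebra.EssFiniteType.isNoetherianRing k ↥(tower O A m)

/-- Every stage of the tower is a local ring (it is `locAt O` of a subalgebra of `O`).
[folklore] -/
theorem isLocalRing_tower (O : ValuationSubring K) (A : Subalgebra k K)
    (hk : ∀ c : k, algebraMap k K c ∈ O) (hAO : A.toSubring ≤ O.toSubring) (m : ℕ) :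
    IsLocalRing ↥(tower O A m) := by
  cases m with
  | zero => exact isLocalRing_locAt O A hAO
  | succ m =>
    exact isLocalRing_locAt O _
      (nrm_toSubring_le O hk (chart_toSubring_le O hk (tower_toSubring_le O hk hAO m)))

/-! ## The curve case -/

/-- **Registered glue stub `stub_curveCase` (crux stmt-ResolutionOfSingularities-17044, line
`birth`) — the curve case of `RankOneTermination`, unconditionally.** If `tr.deg_k K ≤ 1`
(`syzygyIndex k K ≤ 1`) then the first stage `T₁ = tower O A 1` is a regular local ring, for every
valuation ring `O` of `K` containing the finitely generated model `A` (`Frac A = K`): `T₁` is an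
integrally closed (`stub_stageNormal`) Noetherian local domain of Krull dimension `≤ 1`
(`stub_stageDim`), hence a field or a discrete valuation ring, hence regular.
[cite: Matsumura1987, Thm. 11.2] -/
theorem stub_curveCase : ∀ (k K : Type) [Field k] [Field K] [Algebra k K]
    (O : ValuationSubring K) (A : Subalgebra k K), (∀ c : k, algebraMap k K c ∈ O) → A.FG →
      IsFractionRing ↥A K → A.toSubring ≤ O.toSubring → syzygyIndex k K ≤ 1 →
      IsRegularLocalRing ↥(tower O A 1) := by
  intro k K _ _ _ O A hk hFG hFrac hAO hn
  haveI := stub_stageNormal k K O A hk hFG hFrac hAO 0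
  haveI := isNoetherianRing_tower O A hk hFG hFrac hAO 1
  haveI := isLocalRing_tower O A hk hAO 1
  have hd : ringKrullDim ↥(tower O A 1) ≤ 1 :=
    calc ringKrullDim ↥(tower O A 1) ≤ (syzygyIndex k K : WithBot ℕ∞) :=
        stub_stageDim k K O A hk hFG hFrac hAO 1
      _ ≤ 1 := by exact_mod_cast hn
  exact Literature.AlgebraicGeometry.Resolution.isRegularLocalRing_of_isIntegrallyClosed_of_ringKrullDim_le_one
    ↥(tower O A 1) hd

/-- **The curve case of the crux**: for `tr.deg_k K ≤ 1` the tower terminates (at stage `1`)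
along EVERY valuation ring `O ⊇ A` of `K`. [cite: Matsumura1987, Thm. 11.2] -/
theorem towerTerminates_of_syzygyIndex_le_one (O : ValuationSubring K) (A : Subalgebra k K)
    (hk : ∀ c : k, algebraMap k K c ∈ O) (hFG : A.FG) (hFrac : IsFractionRing ↥A K)
    (hAO : A.toSubring ≤ O.toSubring) (hn : syzygyIndex k K ≤ 1) : TowerTerminates O A :=
  ⟨1, stub_curveCase k K O A hk hFG hFrac hAO hn⟩

/-! ## Surfaces: every stage from `T₁` on is isolated -/

/-- **Registered glue stub `stub_surfaceIsolated` (crux stmt-ResolutionOfSingularities-17044,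
line `birth`) — on surfaces every stage from `T₁` on is isolated.** If `tr.deg_k K ≤ 2` then for
every `m ≥ 1` and every non-maximal prime `𝔭` of `tower O A m`, the localisation at `𝔭` is a
regular local ring: the stage is a normal Noetherian domain of dimension `≤ 2`
(`stub_stageNormal`, `stub_stageDim`), and those are `R₁` off the maximal ideals
(`stub_R1_of_normal`). [cite: Matsumura1987, Thm. 11.5 (normal ⇒ R₁)] -/
theorem stub_surfaceIsolated : ∀ (k K : Type) [Field k] [Field K] [Algebra k K]
    (O : ValuationSubring K) (A : Subalgebra k K), (∀ c : k, algebraMap k K c ∈ O) → A.FG →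
      IsFractionRing ↥A K → A.toSubring ≤ O.toSubring → syzygyIndex k K ≤ 2 →
      ∀ m : ℕ, 1 ≤ m → ∀ 𝔭 : PrimeSpectrum ↥(tower O A m), ¬ 𝔭.asIdeal.IsMaximal →
        IsRegularLocalRing (Localization.AtPrime 𝔭.asIdeal) := by
  intro k K _ _ _ O A hk hFG hFrac hAO hn m hm 𝔭 h𝔭
  obtain ⟨j, rfl⟩ := Nat.exists_eq_add_of_le' hm
  haveI := stub_stageNormal k K O A hk hFG hFrac hAO j
  haveI := isNoetherianRing_tower O A hk hFG hFrac hAO (j + 1)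
  have hd : ringKrullDim ↥(tower O A (j + 1)) ≤ 2 :=
    calc ringKrullDim ↥(tower O A (j + 1)) ≤ (syzygyIndex k K : WithBot ℕ∞) :=
        stub_stageDim k K O A hk hFG hFrac hAO (j + 1)
      _ ≤ 2 := by exact_mod_cast hn
  exact stub_R1_of_normal ↥(tower O A (j + 1)) hd 𝔭 h𝔭

/-! ## A terminating tower is eventually isolated -/

/-- Transport of the isolation predicate along an equality of stages (subalgebras of `K`).
[folklore] -/
theorem isolated_of_eq {B C : Subalgebra k K} (e : B = C)
    (h : ∀ 𝔭 : PrimeSpectrum ↥B, ¬ 𝔭.asIdeal.IsMaximal →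
      IsRegularLocalRing (Localization.AtPrime 𝔭.asIdeal)) :
    ∀ 𝔭 : PrimeSpectrum ↥C, ¬ 𝔭.asIdeal.IsMaximal →
      IsRegularLocalRing (Localization.AtPrime 𝔭.asIdeal) := by
  subst e
  exact h

/-- A regular stage is isolated: every localisation of a regular local ring at a prime is regular
(Serre, tree `isRegularLocalRing_localization_atPrime`). [cite: Matsumura1987, Thm. 19.3] -/
theorem isolated_of_isRegularLocalRing (B : Subalgebra k K) [IsRegularLocalRing ↥B] :
    ∀ 𝔭 : PrimeSpectrum ↥B, ¬ 𝔭.asIdeal.IsMaximal →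
      IsRegularLocalRing (Localization.AtPrime 𝔭.asIdeal) :=
  fun 𝔭 _ =>
    Literature.AlgebraicGeometry.Resolution.isRegularLocalRing_localization_atPrime ↥B 𝔭.asIdeal

/-- **A terminating tower is eventually isolated**: if `tower O A m₁` is regular, every later
stage equals it (`tower_eq_of_regular`) and is therefore isolated. [folklore] -/
theorem eventually_isolated_of_towerTerminates (O : ValuationSubring K) (A : Subalgebra k K)
    (hk : ∀ c : k, algebraMap k K c ∈ O) (hFrac : IsFractionRing ↥A K)
    (hAO : A.toSubring ≤ O.toSubring) (h : TowerTerminates O A) :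
    ∃ m₀ : ℕ, ∀ m : ℕ, m₀ ≤ m → ∀ 𝔭 : PrimeSpectrum ↥(tower O A m), ¬ 𝔭.asIdeal.IsMaximal →
      IsRegularLocalRing (Localization.AtPrime 𝔭.asIdeal) := by
  obtain ⟨m₁, hreg⟩ := h
  refine ⟨m₁, fun m hm => ?_⟩
  obtain ⟨j, rfl⟩ := Nat.exists_eq_add_of_le hm
  haveI := hreg
  exact isolated_of_eq (tower_eq_of_regular O A hk hFrac hAO m₁ hreg j).symm
    (isolated_of_isRegularLocalRing (tower O A m₁))

/-! ## The reduction of the crux to its two open cores -/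

/-- **Registered glue stub `stub_rankOneReduction` (crux stmt-ResolutionOfSingularities-17044,
line `birth`) — `RankOneTermination ↔ IsoHigher ∧ IsolatedTerminates`, kernel-checked.**
`IsoHigher`: along a rank-one dimension-zero valuation with `tr.deg_k K ≥ 3` the tower is
eventually isolated.  `IsolatedTerminates`: for `tr.deg_k K ≥ 2` an eventually isolated tower
terminates.  (`→`) a terminating tower is eventually isolated
(`eventually_isolated_of_towerTerminates`), and termination is the crux itself.  (`←`)
`n = tr.deg_k K ≥ 1` (`stub_syzygyIndex_pos`); `n = 1`: the curve case (`stub_curveCase`);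
`n = 2`: every stage from `T₁` on is isolated (`stub_surfaceIsolated`), so `IsolatedTerminates`
applies with `m₀ = 1`; `n ≥ 3`: `IsoHigher` supplies `m₀`.  These two statements are exactly the
registered open stubs `stub_isoHigher`, `stub_isolatedTerminates` of the line. [folklore] -/
theorem stub_rankOneReduction : RankOneTermination ↔
    ((∀ (p : ℕ), p.Prime → ∀ (k K : Type) [Field k] [CharP k p] [Field K] [Algebra k K]
        (O : ValuationSubring K) (A : Subalgebra k K), (∀ c : k, algebraMap k K c ∈ O) → A.FG →
        IsFractionRing ↥A K → A.toSubring ≤ O.toSubring → DimZero k O → ringKrullDim ↥O = 1 →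
        3 ≤ syzygyIndex k K →
        ∃ m₀ : ℕ, ∀ m : ℕ, m₀ ≤ m → ∀ 𝔭 : PrimeSpectrum ↥(tower O A m), ¬ 𝔭.asIdeal.IsMaximal →
          IsRegularLocalRing (Localization.AtPrime 𝔭.asIdeal)) ∧
      (∀ (p : ℕ), p.Prime → ∀ (k K : Type) [Field k] [CharP k p] [Field K] [Algebra k K]
        (O : ValuationSubring K) (A : Subalgebra k K), (∀ c : k, algebraMap k K c ∈ O) → A.FG →
        IsFractionRing ↥A K → A.toSubring ≤ O.toSubring → DimZero k O → ringKrullDim ↥O = 1 →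
        2 ≤ syzygyIndex k K →
        ∀ m₀ : ℕ, (∀ m : ℕ, m₀ ≤ m → ∀ 𝔭 : PrimeSpectrum ↥(tower O A m),
          ¬ 𝔭.asIdeal.IsMaximal → IsRegularLocalRing (Localization.AtPrime 𝔭.asIdeal)) →
        TowerTerminates O A)) := by
  constructor
  · intro hR
    have hR' : ∀ p : ℕ, p.Prime → RankOneInput p := rankOneTermination_iff.mp hR
    refine ⟨?_, ?_⟩
    · intro p hp k K _ _ _ _ O A hk hFG hFrac hAO hdim0 hrk _
      exact eventually_isolated_of_towerTerminates O A hk hFrac hAO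
        (hR' p hp k K O A hk hFG hFrac hAO hdim0 hrk)
    · intro p hp k K _ _ _ _ O A hk hFG hFrac hAO hdim0 hrk _ _ _
      exact hR' p hp k K O A hk hFG hFrac hAO hdim0 hrk
  · rintro ⟨hI, hT⟩
    intro p hp k K _ _ _ _ O A hk hFG hFrac hAO hdim0 hrk
    -- the goal is the route's `let`-block; it is `TowerTerminates O A` on the nose
    show TowerTerminates O A
    have hdim0' : DimZero k O := hdim0
    have hn1 : 1 ≤ syzygyIndex k K := stub_syzygyIndex_pos k K O A hk hFG hFrac hAO hrk
    by_cases h1 : syzygyIndex k K = 1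
    · exact towerTerminates_of_syzygyIndex_le_one O A hk hFG hFrac hAO h1.le
    have hn2 : 2 ≤ syzygyIndex k K := by omega
    by_cases h2 : syzygyIndex k K = 2
    · exact hT p hp k K O A hk hFG hFrac hAO hdim0' hrk hn2 1
        (stub_surfaceIsolated k K O A hk hFG hFrac hAO h2.le)
    · have hn3 : 3 ≤ syzygyIndex k K := by omega
      obtain ⟨m₀, hm₀⟩ := hI p hp k K O A hk hFG hFrac hAO hdim0' hrk hn3
      exact hT p hp k K O A hk hFG hFrac hAO hdim0' hrk hn2 m₀ hm₀

end Summit.ResolutionOfSingularities.ResolutionOfSingularities.Theorems.SyzygyFlattening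

end
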